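import Mathlib.MeasureTheory.Measure.Haar.InnerProductSpace
import Mathlib.MeasureTheory.Measure.Haar.Unique
import Mathlib.MeasureTheory.Integral.Prod
import Mathlib.Analysis.SpecialFunctions.Gaussian.FourierTransform
import Mathlib.Analysis.InnerProductSpace.Projection.FiniteDimensional
import Mathlib.Geometry.Euclidean.Volume.Measure
import HarnessLib

/-!
# Lebesgue measure of an inner product space is the product along `K ⊕ Kᗮ`

For a finite-dimensional real inner product space `E` and a subspace `K`, the linear
isomorphism `K × Kᗮ → E`, `(a, b) ↦ a + b`, pushes the product of the volume measures of the
inner product spaces `K` and `Kᗮ` forward to the volume measure of `E`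
(`map_add_volume_prod_orthogonal`). Both sides are additive Haar measures, so they are
proportional (Mathlib's uniqueness of Haar measure), and the constant is pinned by the Gaussian
`∫ e^{-π‖x‖²} = 1` on each of `E`, `K`, `Kᗮ` together with Pythagoras
`‖a + b‖² = ‖a‖² + ‖b‖²`. Consequences: the change of variables for `ℝ≥0∞`-valued integrals
(`lintegral_volume_eq_lintegral_prod_orthogonal`) and the measure of "product sets"
`{x | P_K x ∈ A, P_{Kᗮ} x ∈ B}` (`volume_setOf_orthogonalProjection_mem_prod`), also for the
Euclidean Hausdorff measure `μHE[dim E] = volume`. The same is proved for an *internal* orthogonal sum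
`K₁ ⊔ K₂` of orthogonal subspaces `K₁ ⟂ K₂` (`map_add_volume_prod_of_isOrtho`,
`volume_sup_setOf_orthogonalProjection_mem_prod`, `finrank_sup_of_isOrtho`). Support file for the product structure of the
Hausdorff measure on round cylinders `S^k × ℝ^{n-k}`
(`Literature.Geometry.Riemannian.Stone1994_cylinderEntropy`).

## References

* H. Federer, *Geometric measure theory* (1969), 2.6.2 (Fubini), 2.7.16.
-/

noncomputable section

open Set Module Submodule
open _root_.MeasureTheory _root_.MeasureTheory.Measure
open scoped ENNReal NNReal RealInnerProductSpace

namespace Literature.MeasureTheory.Hausdorff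

variable {E : Type*} [NormedAddCommGroup E] [InnerProductSpace ℝ E] [FiniteDimensional ℝ E]
  [MeasurableSpace E] [BorelSpace E] (K : Submodule ℝ E)

/-- The Gaussian normalised to have integral one: `∫_V e^{-π‖v‖²} dv = 1` on every
finite-dimensional real inner product space. [folklore] -/
theorem integral_exp_neg_pi_mul_sq_norm (W : Type*) [NormedAddCommGroup W] [InnerProductSpace ℝ W]
    [FiniteDimensional ℝ W] [MeasurableSpace W] [BorelSpace W] :
    ∫ w : W, Real.exp (-Real.pi * ‖w‖ ^ 2) = 1 := by
  rw [GaussianFourier.integral_rexp_neg_mul_sq_norm Real.pi_pos, div_self Real.pi_pos.ne',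
    Real.one_rpow]

/-- **Lebesgue measure splits along an orthogonal decomposition.** For a subspace `K` of a
finite-dimensional real inner product space `E`, the map `(a, b) ↦ a + b` from `K × Kᗮ` pushes
`volume ⊗ volume` forward to `volume` on `E`. [folklore] -/
theorem map_add_volume_prod_orthogonal :
    Measure.map (fun p : K × Kᗮ ↦ (p.1 : E) + (p.2 : E))
      ((volume : Measure K).prod (volume : Measure Kᗮ)) = (volume : Measure E) := by
  -- the linear isomorphism `K × Kᗮ ≃ E`
  set Φ : (K × Kᗮ) ≃L[ℝ] E :=
    (Submodule.prodEquivOfIsCompl K Kᗮ K.isCompl_orthogonal).toContinuousLinearEquiv with hΦ_def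
  have hΦ : ∀ p : K × Kᗮ, Φ p = (p.1 : E) + (p.2 : E) := fun p ↦ rfl
  have hfun : (fun p : K × Kᗮ ↦ (p.1 : E) + (p.2 : E)) = Φ := funext fun p ↦ (hΦ p).symm
  rw [hfun]
  set μ' : Measure E := Measure.map Φ ((volume : Measure K).prod (volume : Measure Kᗮ)) with hμ'
  haveI : IsAddHaarMeasure μ' := Φ.isAddHaarMeasure_map _
  -- uniqueness of Haar measure: `μ' = c • volume`
  have hc := Measure.isAddLeftInvariant_eq_smul μ' (volume : Measure E)
  set c : ℝ≥0 := Measure.addHaarScalarFactor μ' (volume : Measure E) with hc_def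
  -- pin `c` with the Gaussian
  have hgauss : ∫ x, Real.exp (-Real.pi * ‖x‖ ^ 2) ∂μ' = 1 := by
    rw [hμ', integral_map Φ.continuous.measurable.aemeasurable (by fun_prop)]
    have hpyth : ∀ p : K × Kᗮ, Real.exp (-Real.pi * ‖Φ p‖ ^ 2) =
        Real.exp (-Real.pi * ‖p.1‖ ^ 2) * Real.exp (-Real.pi * ‖p.2‖ ^ 2) := by
      intro p
      rw [hΦ, ← Real.exp_add]
      congr 1
      have h0 : ⟪(p.1 : E), (p.2 : E)⟫ = 0 := Submodule.inner_right_of_mem_orthogonal p.1.2 p.2.2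
      have h := norm_add_sq_eq_norm_sq_add_norm_sq_of_inner_eq_zero _ _ h0
      have h1 : ‖(p.1 : E)‖ = ‖p.1‖ := rfl
      have h2 : ‖(p.2 : E)‖ = ‖p.2‖ := rfl
      rw [h1, h2] at h
      rw [sq, h]
      ring
    simp_rw [hpyth]
    rw [integral_prod_mul (fun a : K ↦ Real.exp (-Real.pi * ‖a‖ ^ 2))
        (fun b : Kᗮ ↦ Real.exp (-Real.pi * ‖b‖ ^ 2)),
      integral_exp_neg_pi_mul_sq_norm K, integral_exp_neg_pi_mul_sq_norm Kᗮ, mul_one]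
  have hc1 : c = 1 := by
    have h1 : ∫ x, Real.exp (-Real.pi * ‖x‖ ^ 2) ∂μ' =
        (c : ℝ) * ∫ x : E, Real.exp (-Real.pi * ‖x‖ ^ 2) := by
      conv_lhs => rw [hc]
      rw [integral_smul_nnreal_measure]
      rfl
    rw [hgauss, integral_exp_neg_pi_mul_sq_norm E, mul_one] at h1
    exact_mod_cast h1.symm
  rw [hc, hc1, one_smul]

/-- **Fubini along `K ⊕ Kᗮ` for `ℝ≥0∞`-valued functions**:
`∫⁻ f dvol_E = ∫⁻∫⁻ f (a + b) dvol_{Kᗮ}(b) dvol_K(a)` for measurable `f`. [folklore] -/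
theorem lintegral_volume_eq_lintegral_prod_orthogonal {f : E → ℝ≥0∞} (hf : Measurable f) :
    ∫⁻ x, f x ∂(volume : Measure E) =
      ∫⁻ p : K × Kᗮ, f ((p.1 : E) + (p.2 : E)) ∂((volume : Measure K).prod (volume : Measure Kᗮ)) := by
  rw [← map_add_volume_prod_orthogonal K, lintegral_map hf (by fun_prop)]

/-- **Volume of a product set along `K ⊕ Kᗮ`**: for measurable `A ⊆ K`, `B ⊆ Kᗮ`,
`vol_E {x | P_K x ∈ A ∧ P_{Kᗮ} x ∈ B} = vol_K (A) · vol_{Kᗮ} (B)`. [folklore] -/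
theorem volume_setOf_orthogonalProjection_mem_prod {A : Set K} {B : Set Kᗮ}
    (hA : MeasurableSet A) (hB : MeasurableSet B) :
    (volume : Measure E) {x | K.orthogonalProjectionOnto x ∈ A ∧ Kᗮ.orthogonalProjectionOnto x ∈ B} =
      volume A * volume B := by
  have hmeas : MeasurableSet {x : E | K.orthogonalProjectionOnto x ∈ A ∧ Kᗮ.orthogonalProjectionOnto x ∈ B} :=
    (K.orthogonalProjectionOnto.continuous.measurable hA).inter
      (Kᗮ.orthogonalProjectionOnto.continuous.measurable hB)
  rw [← map_add_volume_prod_orthogonal K, Measure.map_apply (by fun_prop) hmeas]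
  have hpre : (fun p : K × Kᗮ ↦ (p.1 : E) + (p.2 : E)) ⁻¹'
      {x : E | K.orthogonalProjectionOnto x ∈ A ∧ Kᗮ.orthogonalProjectionOnto x ∈ B} = A ×ˢ B := by
    ext p
    simp only [mem_preimage, mem_setOf_eq, mem_prod, map_add,
      orthogonalProjectionOnto_mem_subspace_eq_self,
      orthogonalProjectionOnto_apply_of_mem_orthogonal p.2.2,
      orthogonalProjectionOnto_orthogonal_apply_eq_zero p.1.2, add_zero, zero_add]
  rw [hpre, Measure.prod_prod]

/-- The same product formula for the Euclidean Hausdorff measure `μHE[dim E]` (`= volume`).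
[folklore] -/
theorem euclideanHausdorffMeasure_setOf_orthogonalProjection_mem_prod {n : ℕ}
    (hE : finrank ℝ E = n) {A : Set K} {B : Set Kᗮ} (hA : MeasurableSet A) (hB : MeasurableSet B) :
    (μHE[n] : Measure E) {x | K.orthogonalProjectionOnto x ∈ A ∧ Kᗮ.orthogonalProjectionOnto x ∈ B} =
      volume A * volume B := by
  subst hE
  rw [InnerProductSpace.euclideanHausdorffMeasure_eq_volume]
  exact volume_setOf_orthogonalProjection_mem_prod K hA hB

/-! ### Internal orthogonal sums `K₁ ⊕ K₂ ≤ E` -/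

section IsOrtho

variable {K} (K₁ K₂ : Submodule ℝ E)

omit [MeasurableSpace E] [BorelSpace E] in
/-- The addition map `K₁ × K₂ → K₁ ⊔ K₂` as a continuous linear isomorphism, for orthogonal
subspaces `K₁ ⟂ K₂`. [folklore] -/
theorem exists_continuousLinearEquiv_prod_sup (h : K₁ ⟂ K₂) :
    ∃ Φ : (K₁ × K₂) ≃L[ℝ] ↥(K₁ ⊔ K₂), ∀ p : K₁ × K₂, (Φ p : E) = (p.1 : E) + (p.2 : E) := by
  set L : K₁ × K₂ →ₗ[ℝ] ↥(K₁ ⊔ K₂) := LinearMap.codRestrict (K₁ ⊔ K₂) (K₁.subtype.coprod K₂.subtype)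
    (fun p ↦ Submodule.add_mem_sup p.1.2 p.2.2) with hL_def
  have hL : ∀ p : K₁ × K₂, (L p : E) = (p.1 : E) + (p.2 : E) := fun p ↦ rfl
  have hinj : Function.Injective L := by
    intro p q hpq
    have h1 : (L p : E) = (L q : E) := by rw [hpq]
    rw [hL, hL] at h1
    -- `(p.1 - q.1) + (p.2 - q.2) = 0` with the two summands orthogonal
    have hsum : ((p.1 : E) - q.1) + ((p.2 : E) - q.2) = 0 := by
      rw [← sub_eq_zero] at h1
      rw [← h1]
      abel
    have horth : ⟪(p.1 : E) - q.1, (p.2 : E) - q.2⟫ = 0 :=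
      h.inner_eq (K₁.sub_mem p.1.2 q.1.2) (K₂.sub_mem p.2.2 q.2.2)
    have h0 : (p.1 : E) - q.1 = 0 := by
      have h2 : (p.2 : E) - q.2 = -((p.1 : E) - q.1) := by
        rw [eq_neg_iff_add_eq_zero, add_comm]; exact hsum
      rw [h2, inner_neg_right, neg_eq_zero, real_inner_self_eq_norm_sq] at horth
      exact norm_eq_zero.1 (by nlinarith [norm_nonneg ((p.1 : E) - q.1)])
    have h0' : (p.2 : E) - q.2 = 0 := by
      rw [h0, zero_add] at hsum; exact hsum
    rw [sub_eq_zero] at h0 h0'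
    exact Prod.ext (Subtype.ext h0) (Subtype.ext h0')
  have hsurj : Function.Surjective L := by
    intro w
    obtain ⟨y, hy, z, hz, hyz⟩ := Submodule.mem_sup.1 w.2
    refine ⟨(⟨y, hy⟩, ⟨z, hz⟩), Subtype.ext ?_⟩
    rw [hL]
    exact hyz
  refine ⟨(LinearEquiv.ofBijective L ⟨hinj, hsurj⟩).toContinuousLinearEquiv, fun p ↦ ?_⟩
  exact hL p

/-- **Lebesgue measure of an internal orthogonal sum** `K₁ ⊕ K₂` (`K₁ ⟂ K₂` subspaces of a
finite-dimensional real inner product space): the addition map `K₁ × K₂ → K₁ ⊔ K₂` pushes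
`volume ⊗ volume` forward to the volume of the inner product space `K₁ ⊔ K₂`. [folklore] -/
theorem map_add_volume_prod_of_isOrtho (h : K₁ ⟂ K₂) :
    Measure.map (fun p : K₁ × K₂ ↦
        (⟨(p.1 : E) + (p.2 : E), Submodule.add_mem_sup p.1.2 p.2.2⟩ : ↥(K₁ ⊔ K₂)))
      ((volume : Measure K₁).prod (volume : Measure K₂)) = (volume : Measure ↥(K₁ ⊔ K₂)) := by
  obtain ⟨Φ, hΦ⟩ := exists_continuousLinearEquiv_prod_sup K₁ K₂ h
  have hfun : (fun p : K₁ × K₂ ↦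
      (⟨(p.1 : E) + (p.2 : E), Submodule.add_mem_sup p.1.2 p.2.2⟩ : ↥(K₁ ⊔ K₂))) = Φ :=
    funext fun p ↦ Subtype.ext (by rw [hΦ p])
  rw [hfun]
  set μ' : Measure ↥(K₁ ⊔ K₂) := Measure.map Φ ((volume : Measure K₁).prod (volume : Measure K₂))
    with hμ'
  haveI : IsAddHaarMeasure μ' := Φ.isAddHaarMeasure_map _
  have hc := Measure.isAddLeftInvariant_eq_smul μ' (volume : Measure ↥(K₁ ⊔ K₂))
  set c : ℝ≥0 := Measure.addHaarScalarFactor μ' (volume : Measure ↥(K₁ ⊔ K₂)) with hc_def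
  have hgauss : ∫ x, Real.exp (-Real.pi * ‖x‖ ^ 2) ∂μ' = 1 := by
    rw [hμ', integral_map Φ.continuous.measurable.aemeasurable (by fun_prop)]
    have hpyth : ∀ p : K₁ × K₂, Real.exp (-Real.pi * ‖Φ p‖ ^ 2) =
        Real.exp (-Real.pi * ‖p.1‖ ^ 2) * Real.exp (-Real.pi * ‖p.2‖ ^ 2) := by
      intro p
      rw [← Real.exp_add]
      congr 1
      have h0 : ⟪(p.1 : E), (p.2 : E)⟫ = 0 := h.inner_eq p.1.2 p.2.2
      have h' := norm_add_sq_eq_norm_sq_add_norm_sq_of_inner_eq_zero _ _ h0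
      have h1 : ‖(p.1 : E)‖ = ‖p.1‖ := rfl
      have h2 : ‖(p.2 : E)‖ = ‖p.2‖ := rfl
      have h3 : ‖Φ p‖ = ‖(Φ p : E)‖ := rfl
      rw [h1, h2, ← hΦ p, ← h3] at h'
      rw [sq, h']
      ring
    simp_rw [hpyth]
    rw [integral_prod_mul (fun a : K₁ ↦ Real.exp (-Real.pi * ‖a‖ ^ 2))
        (fun b : K₂ ↦ Real.exp (-Real.pi * ‖b‖ ^ 2)),
      integral_exp_neg_pi_mul_sq_norm K₁, integral_exp_neg_pi_mul_sq_norm K₂, mul_one]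
  have hc1 : c = 1 := by
    have h1 : ∫ x, Real.exp (-Real.pi * ‖x‖ ^ 2) ∂μ' =
        (c : ℝ) * ∫ x : ↥(K₁ ⊔ K₂), Real.exp (-Real.pi * ‖x‖ ^ 2) := by
      conv_lhs => rw [hc]
      rw [integral_smul_nnreal_measure]
      rfl
    rw [hgauss, integral_exp_neg_pi_mul_sq_norm ↥(K₁ ⊔ K₂), mul_one] at h1
    exact_mod_cast h1.symm
  rw [hc, hc1, one_smul]

/-- **Volume of a product set in an internal orthogonal sum**: for `K₁ ⟂ K₂` and measurable
`A ⊆ K₁`, `B ⊆ K₂`, the subset `{w | P_{K₁} w ∈ A ∧ P_{K₂} w ∈ B}` of the inner product space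
`K₁ ⊔ K₂` has volume `vol_{K₁} (A) · vol_{K₂} (B)`. [folklore] -/
theorem volume_sup_setOf_orthogonalProjection_mem_prod (h : K₁ ⟂ K₂) {A : Set K₁} {B : Set K₂}
    (hA : MeasurableSet A) (hB : MeasurableSet B) :
    (volume : Measure ↥(K₁ ⊔ K₂))
        {w | K₁.orthogonalProjectionOnto (w : E) ∈ A ∧ K₂.orthogonalProjectionOnto (w : E) ∈ B} =
      volume A * volume B := by
  have hmeas : MeasurableSet {w : ↥(K₁ ⊔ K₂) |
      K₁.orthogonalProjectionOnto (w : E) ∈ A ∧ K₂.orthogonalProjectionOnto (w : E) ∈ B} :=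
    ((K₁.orthogonalProjectionOnto.continuous.comp continuous_subtype_val).measurable hA).inter
      ((K₂.orthogonalProjectionOnto.continuous.comp continuous_subtype_val).measurable hB)
  rw [← map_add_volume_prod_of_isOrtho K₁ K₂ h, Measure.map_apply (by fun_prop) hmeas]
  have h12 : K₂ ≤ K₁ᗮ := h.symm.le
  have h21 : K₁ ≤ K₂ᗮ := h.le
  have hpre : (fun p : K₁ × K₂ ↦
      (⟨(p.1 : E) + (p.2 : E), Submodule.add_mem_sup p.1.2 p.2.2⟩ : ↥(K₁ ⊔ K₂))) ⁻¹'
      {w | K₁.orthogonalProjectionOnto (w : E) ∈ A ∧ K₂.orthogonalProjectionOnto (w : E) ∈ B} =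
      A ×ˢ B := by
    ext p
    simp only [mem_preimage, mem_setOf_eq, mem_prod, map_add,
      orthogonalProjectionOnto_mem_subspace_eq_self,
      orthogonalProjectionOnto_apply_of_mem_orthogonal (h12 p.2.2),
      orthogonalProjectionOnto_apply_of_mem_orthogonal (h21 p.1.2), add_zero, zero_add]
  rw [hpre, Measure.prod_prod]

omit [MeasurableSpace E] [BorelSpace E] in
/-- The dimension of an internal orthogonal sum is the sum of the dimensions. [folklore] -/
theorem finrank_sup_of_isOrtho (h : K₁ ⟂ K₂) :
    finrank ℝ ↥(K₁ ⊔ K₂) = finrank ℝ K₁ + finrank ℝ K₂ := by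
  have hinf : K₁ ⊓ K₂ = ⊥ := by
    rw [eq_bot_iff]
    intro x hx
    have h0 : ⟪x, x⟫ = 0 := h.inner_eq hx.1 hx.2
    rw [Submodule.mem_bot]
    exact inner_self_eq_zero.1 h0
  have := Submodule.finrank_sup_add_finrank_inf_eq K₁ K₂
  rw [hinf, finrank_bot, add_zero] at this
  exact this

end IsOrtho

end Literature.MeasureTheory.Hausdorff

end
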